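import Summits.CriticalPhenomena.PercolationContinuityZ3.Theorems.FK.InfiniteVolumeMeasures
import Summits.CriticalPhenomena.PercolationContinuityZ3.Theorems.FK.RandomClusterFiniteEnergy
import Literature.Probability.Percolation.DeletionTolerance
import HarnessLib

/-!
# FK-continuity transplant, FO-06 (construction half): finite energy of the free and wired
# infinite-volume random-cluster measures on `ℤ^d` — insertion and deletion tolerance

Cell `fk-continuity` (bschramm), row FO-06 seat B; support file for the FK-continuity transplant
(`--supports stmt-CriticalPhenomena-4575`); builds on p205010 (kernel theorem, internal audit signed;
external expert review pending). No named facts, no sorries, standard axioms. General dimension `d`.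

Grimmett 2006, Thm. (4.17)(a) / (3.4) (finite energy of the limit measures: "`φ(J_e | T_e)` lies
between `p/(p + q(1-p))` and `p`"), in the integrated form used by the Burton–Keane and
local-modification arguments, for every box limit `P` (`IsBoxLimit d b p q P`, `0 ≤ p ≤ 1`, `q ≥ 1`,
either boundary condition) and every finite set `F` of edges of `ℤ^d`:

* `IsBoxLimit.pow_mul_real_preimage_openEdges_le` — **insertion tolerance**:
  `(p/(p+q(1-p)))^{|F|} · P{ω | ω ∪ F ∈ A} ≤ P(A)` for every measurable `A`;
* `IsBoxLimit.pow_mul_real_preimage_sdiff_le` — **deletion tolerance**: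
  `(1-p)^{|F|} · P{ω | ω ∖ F ∈ A} ≤ P(A)` for every measurable `A` (any finite set `F` of pairs);
* the box forms consumed downstream: `IsBoxLimit.insertion_tolerant` (the `insertion_tolerant`
  field of the tree's `IsInsertionTolerantErgodic`, `UniquenessInsertionTolerant.lean`; `0 < p`) and
  `IsBoxLimit.isDeletionTolerant` (the tree's `IsDeletionTolerant`, `DeletionTolerance.lean`;
  `p < 1`), with the `rcLimit` versions.

Proof: the finite-volume inequalities (`RandomClusterFiniteEnergy.lean`) hold for the box laws as
soon as the box contains `F` (the lift `liftEdges` commutes with opening/closing the lifted copy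
of `F`), pass to the limit on local events (`openEdges F ⁻¹' A`, `(· ∖ F) ⁻¹' A` are local with `A`),
and extend from local to all measurable events by the tree's approximation lemma
`measure_le_of_forall_isLocalEvent_le` (`LocalEventsComparison.lean`; for insertion this is
`mul_measure_preimage_union_le_of_isLocalEvent`, `LocalLimitMeasure.lean`).

## References

* G. Grimmett, *The Random-Cluster Model*, Springer 2006: Thm. (3.1), eq. (3.4); Thm. (4.17)(a),
  Thm. (4.19); (4.33)(b)–(c) context. [Grimmett2006]
* R. M. Burton, M. Keane, Comm. Math. Phys. 121 (1989) 501–505 (finite energy). [BurtonKeane1989]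
-/

noncomputable section

open MeasureTheory Set Filter
open scoped Topology ENNReal

namespace Summit.CriticalPhenomena.PercolationContinuityZ3.Theorems.FK

open Literature.Probability.Percolation Literature.Probability.LatticeModels

variable {d : ℕ}

/-! ### The lifted copy of a finite edge set inside a box -/

/-- The copy, among the pairs of vertices of the box `Λ_n`, of a finite set `F` of pairs of `ℤ^d`:
the preimage of `F` under `Sym2.map Subtype.val`. [folklore] -/
theorem exists_finset_preimage_map_val (n : ℕ) (F : Finset (Sym2 (Site d))) :
    ∃ F' : Finset (Sym2 ↥(box d n)), (↑F' : Set (Sym2 ↥(box d n))) = Sym2.map Subtype.val ⁻¹' ↑F ∧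
      F'.card ≤ F.card := by
  classical
  have hinj : Function.Injective (Sym2.map (Subtype.val : ↥(box d n) → Site d)) :=
    Sym2.map.injective Subtype.val_injective
  refine ⟨F.preimage (Sym2.map Subtype.val) hinj.injOn, Finset.coe_preimage F hinj.injOn, ?_⟩
  refine Finset.card_le_card_of_injOn (Sym2.map Subtype.val) (fun e' he' => ?_) hinj.injOn
  exact Finset.mem_preimage.1 he'

/-- If all pairs of `F` lie in the box, `F` is the image of its copy. [folklore] -/
theorem image_map_val_preimage_eq {n : ℕ} {F : Finset (Sym2 (Site d))}
    (hF : ∀ e ∈ F, ∀ z ∈ e, z ∈ box d n) :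
    Sym2.map (Subtype.val : ↥(box d n) → Site d) '' (Sym2.map Subtype.val ⁻¹' ↑F) = ↑F := by
  refine Set.Subset.antisymm (Set.image_preimage_subset _ _) fun e he => ?_
  have he' : e ∈ F := he
  induction e using Sym2.ind with
  | h x y =>
    refine ⟨s(⟨x, hF _ he' x (Sym2.mem_mk_left x y)⟩, ⟨y, hF _ he' y (Sym2.mem_mk_right x y)⟩), ?_, ?_⟩
    · show Sym2.map Subtype.val _ ∈ (↑F : Set (Sym2 (Site d)))
      rw [Sym2.map_mk]
      exact he
    · rw [Sym2.map_mk]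

/-- Lifting commutes with opening the copy of `F`: `liftEdges (ω ∪ F') = liftEdges ω ∪ F`. [folklore] -/
theorem liftEdges_union_preimage {n : ℕ} {F : Finset (Sym2 (Site d))}
    (hF : ∀ e ∈ F, ∀ z ∈ e, z ∈ box d n) (ω : BondConfig ↥(box d n)) :
    liftEdges (box d n) (ω ∪ Sym2.map Subtype.val ⁻¹' ↑F) = liftEdges (box d n) ω ∪ ↑F := by
  rw [liftEdges, liftEdges, Set.image_union, image_map_val_preimage_eq hF]

/-- Lifting commutes with closing the copy of `F`: `liftEdges (ω ∖ F') = liftEdges ω ∖ F`. [folklore] -/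
theorem liftEdges_diff_preimage {n : ℕ} (F : Finset (Sym2 (Site d))) (ω : BondConfig ↥(box d n)) :
    liftEdges (box d n) (ω \ Sym2.map Subtype.val ⁻¹' ↑F) = liftEdges (box d n) ω \ ↑F := by
  have hinj : Function.Injective (Sym2.map (Subtype.val : ↥(box d n) → Site d)) :=
    Sym2.map.injective Subtype.val_injective
  rw [liftEdges, liftEdges, Set.image_sdiff_preimage]

/-- A pair of `E(ℤ^d)` whose copy lies in the box is an edge of the box graph. [folklore] -/
theorem preimage_map_val_subset_edgeFinset {n : ℕ} {F : Finset (Sym2 (Site d))}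
    (hFE : (↑F : Set (Sym2 (Site d))) ⊆ (zdGraph d).edgeSet) (F' : Finset (Sym2 ↥(box d n)))
    (hF' : (↑F' : Set (Sym2 ↥(box d n))) = Sym2.map Subtype.val ⁻¹' ↑F) :
    F' ⊆ (finsetGraph (zdGraph d) (box d n)).edgeFinset := by
  intro e' he'
  have h1 : Sym2.map Subtype.val e' ∈ (↑F : Set (Sym2 (Site d))) := by
    have : e' ∈ (↑F' : Set (Sym2 ↥(box d n))) := he'
    rw [hF'] at this
    exact this
  have h2 := hFE h1
  rw [SimpleGraph.mem_edgeFinset]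
  induction e' using Sym2.ind with
  | h u v =>
    rw [Sym2.map_mk, SimpleGraph.mem_edgeSet] at h2
    exact (SimpleGraph.mem_edgeSet _).2 ((finsetGraph_adj_iff u v).2 h2)

/-! ### Finite energy of the box laws -/

/-- **Insertion tolerance of the box laws**: for a finite set `F` of edges of `ℤ^d` inside `Λ_n`,
`(p/(p+q(1-p)))^{|F|} · φ^b_{Λ_n}{ω | ω ∪ F ∈ A} ≤ φ^b_{Λ_n}(A)` for every measurable `A`
(`0 ≤ p ≤ 1`, `q ≥ 1`). [cite: Grimmett2006, Thm. (3.1), eq. (3.4)] -/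
theorem rcBoxLaw_pow_mul_real_preimage_openEdges_le (b : Bool) {p q : ℝ}
    (hp : p ∈ Set.Icc (0 : ℝ) 1) (hq : 1 ≤ q) {F : Finset (Sym2 (Site d))}
    (hFE : (↑F : Set (Sym2 (Site d))) ⊆ (zdGraph d).edgeSet) {n : ℕ}
    (hF : ∀ e ∈ F, ∀ z ∈ e, z ∈ box d n) {A : Set (BondConfig (Site d))} (hA : MeasurableSet A) :
    (p / (p + q * (1 - p))) ^ F.card * (rcBoxLaw d b p q n).real (openEdges ↑F ⁻¹' A) ≤
      (rcBoxLaw d b p q n).real A := by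
  obtain ⟨F', hF', hcard⟩ := exists_finset_preimage_map_val n F
  have hpre : liftEdges (box d n) ⁻¹' (openEdges ↑F ⁻¹' A) =
      openEdges ↑F' ⁻¹' (liftEdges (box d n) ⁻¹' A) := by
    ext ω
    simp only [Set.mem_preimage, openEdges, hF', liftEdges_union_preimage hF]
  rw [rcBoxLaw_real_apply b p q n ((measurable_openEdges _) hA), rcBoxLaw_real_apply b p q n hA, hpre]
  have hc0 : 0 ≤ p / (p + q * (1 - p)) := div_nonneg hp.1 (insertionDenominator_pos hp hq).le
  have hc1 : p / (p + q * (1 - p)) ≤ 1 := by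
    rw [div_le_one (insertionDenominator_pos hp hq)]
    nlinarith [hp.2, hq]
  calc (p / (p + q * (1 - p))) ^ F.card *
        (rcBoxMeasure d b p q n).real (openEdges ↑F' ⁻¹' (liftEdges (box d n) ⁻¹' A))
      ≤ (p / (p + q * (1 - p))) ^ F'.card *
        (rcBoxMeasure d b p q n).real (openEdges ↑F' ⁻¹' (liftEdges (box d n) ⁻¹' A)) :=
        mul_le_mul_of_nonneg_right (pow_le_pow_of_le_one hc0 hc1 hcard) measureReal_nonneg
    _ ≤ (rcBoxMeasure d b p q n).real (liftEdges (box d n) ⁻¹' A) :=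
        rcMeasure_pow_mul_real_preimage_openEdges_le _ hp hq _
          (preimage_map_val_subset_edgeFinset hFE F' hF') _

/-- **Deletion tolerance of the box laws**: for a finite set `F` of pairs,
`(1-p)^{|F|} · φ^b_{Λ_n}{ω | ω ∖ F ∈ A} ≤ φ^b_{Λ_n}(A)` for every measurable `A` (`0 ≤ p ≤ 1`,
`q ≥ 1`). [cite: Grimmett2006, Thm. (3.1), eq. (3.4)] -/
theorem rcBoxLaw_pow_mul_real_preimage_sdiff_le (b : Bool) {p q : ℝ} (hp : p ∈ Set.Icc (0 : ℝ) 1)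
    (hq : 1 ≤ q) (F : Finset (Sym2 (Site d))) (n : ℕ) {A : Set (BondConfig (Site d))}
    (hA : MeasurableSet A) :
    (1 - p) ^ F.card * (rcBoxLaw d b p q n).real ((fun ω => ω \ ↑F) ⁻¹' A) ≤
      (rcBoxLaw d b p q n).real A := by
  obtain ⟨F', hF', hcard⟩ := exists_finset_preimage_map_val n F
  have hpre : liftEdges (box d n) ⁻¹' ((fun ω : BondConfig (Site d) => ω \ ↑F) ⁻¹' A) =
      (fun ω : BondConfig ↥(box d n) => ω \ ↑F') ⁻¹' (liftEdges (box d n) ⁻¹' A) := by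
    ext ω
    simp only [Set.mem_preimage, hF', liftEdges_diff_preimage F]
  rw [rcBoxLaw_real_apply b p q n (A := (fun ω : BondConfig (Site d) => ω \ ↑F) ⁻¹' A)
    ((measurable_closeEdges _) hA), rcBoxLaw_real_apply b p q n hA, hpre]
  have hc0 : 0 ≤ 1 - p := sub_nonneg.2 hp.2
  have hc1 : 1 - p ≤ 1 := sub_le_self 1 hp.1
  calc (1 - p) ^ F.card *
        (rcBoxMeasure d b p q n).real ((fun ω : BondConfig ↥(box d n) => ω \ ↑F') ⁻¹'
          (liftEdges (box d n) ⁻¹' A))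
      ≤ (1 - p) ^ F'.card *
        (rcBoxMeasure d b p q n).real ((fun ω : BondConfig ↥(box d n) => ω \ ↑F') ⁻¹'
          (liftEdges (box d n) ⁻¹' A)) :=
        mul_le_mul_of_nonneg_right (pow_le_pow_of_le_one hc0 hc1 hcard) measureReal_nonneg
    _ ≤ (rcBoxMeasure d b p q n).real (liftEdges (box d n) ⁻¹' A) :=
        rcMeasure_pow_mul_real_preimage_sdiff_le _ hp hq _ F' _

/-! ### Finite energy of the box limits -/

section Limit

variable {b : Bool} {p q : ℝ} {P : Measure (BondConfig (Site d))}

/-- The event `{ω | ω ∖ F ∈ A}` is local when `A` is. [folklore] -/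
theorem isLocalEvent_preimage_sdiff {ι : Type*} {A : Set (Set ι)} (hA : IsLocalEvent A) (F : Set ι) :
    IsLocalEvent ((fun ω : Set ι => ω \ F) ⁻¹' A) := by
  obtain ⟨J, hJ⟩ := hA
  refine ⟨J, ?_⟩
  rw [determinedBy_iff] at hJ ⊢
  intro ω ω' hω
  simp only [Set.mem_preimage]
  refine hJ _ _ ?_
  rw [Set.sdiff_eq, Set.sdiff_eq, Set.inter_right_comm, hω, Set.inter_right_comm]

/-- **Insertion tolerance of `φ^b_{p,q}` on local events.** [cite: Grimmett2006, Thm. (3.1), eq. (3.4) and Thm. (4.17)(a)] -/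
theorem IsBoxLimit.pow_mul_real_preimage_openEdges_le_of_isLocalEvent (hP : IsBoxLimit d b p q P)
    (hp : p ∈ Set.Icc (0 : ℝ) 1) (hq : 1 ≤ q) {F : Finset (Sym2 (Site d))}
    (hFE : (↑F : Set (Sym2 (Site d))) ⊆ (zdGraph d).edgeSet) {A : Set (BondConfig (Site d))}
    (hA : IsLocalEvent A) :
    (p / (p + q * (1 - p))) ^ F.card * P.real (openEdges ↑F ⁻¹' A) ≤ P.real A := by
  have h1 := (hP.tendsto_real (hA.preimage_openEdges ↑F)).const_mul ((p / (p + q * (1 - p))) ^ F.card)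
  refine le_of_tendsto_of_tendsto h1 (hP.tendsto_real hA) ?_
  filter_upwards [eventually_ge_atTop (F.sup pairRad)] with n hn
  exact rcBoxLaw_pow_mul_real_preimage_openEdges_le b hp hq hFE
    (forall_mem_box_of_sup_pairRad_le hn) (measurableSet_of_isLocalEvent_holds hA)

/-- **Deletion tolerance of `φ^b_{p,q}` on local events.** [cite: Grimmett2006, Thm. (3.1), eq. (3.4) and Thm. (4.17)(a)] -/
theorem IsBoxLimit.pow_mul_real_preimage_sdiff_le_of_isLocalEvent (hP : IsBoxLimit d b p q P)
    (hp : p ∈ Set.Icc (0 : ℝ) 1) (hq : 1 ≤ q) (F : Finset (Sym2 (Site d)))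
    {A : Set (BondConfig (Site d))} (hA : IsLocalEvent A) :
    (1 - p) ^ F.card * P.real ((fun ω => ω \ ↑F) ⁻¹' A) ≤ P.real A := by
  have h1 := (hP.tendsto_real (isLocalEvent_preimage_sdiff hA ↑F)).const_mul ((1 - p) ^ F.card)
  exact le_of_tendsto_of_tendsto' h1 (hP.tendsto_real hA) fun n =>
    rcBoxLaw_pow_mul_real_preimage_sdiff_le b hp hq F n (measurableSet_of_isLocalEvent_holds hA)

/-- From local to all measurable events, for a measurable self-map `T` of the configuration space:
if `c · μ(T⁻¹ A) ≤ μ(A)` for all local `A` (`c ≥ 0`), then for all measurable `A` (the tree's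
`measure_le_of_forall_isLocalEvent_le` applied to `c • μ ∘ T⁻¹`; for `T = (· ∪ F)` this is
`mul_measure_preimage_union_le_of_isLocalEvent`). [folklore] -/
theorem mul_real_preimage_le_of_isLocalEvent {ι : Type*} {μ : Measure (Set ι)} [IsFiniteMeasure μ]
    {T : Set ι → Set ι} (hT : Measurable T) {c : ℝ} (hc : 0 ≤ c)
    (h : ∀ A : Set (Set ι), IsLocalEvent A → c * μ.real (T ⁻¹' A) ≤ μ.real A)
    {s : Set (Set ι)} (hs : MeasurableSet s) : c * μ.real (T ⁻¹' s) ≤ μ.real s := by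
  set ν : Measure (Set ι) := ENNReal.ofReal c • μ.map T with hν
  haveI : IsFiniteMeasure (μ.map T) := Measure.isFiniteMeasure_map μ _
  haveI : IsFiniteMeasure ν := by
    refine ⟨?_⟩
    rw [hν, Measure.smul_apply, smul_eq_mul]
    exact ENNReal.mul_lt_top ENNReal.ofReal_lt_top (measure_lt_top _ _)
  have hνapply : ∀ A : Set (Set ι), MeasurableSet A →
      ν A = ENNReal.ofReal c * μ (T ⁻¹' A) := by
    intro A hA
    rw [hν, Measure.smul_apply, smul_eq_mul, Measure.map_apply hT hA]
  have hνreal : ∀ A : Set (Set ι), MeasurableSet A → ν.real A = c * μ.real (T ⁻¹' A) := by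
    intro A hA
    rw [measureReal_def, hνapply A hA, ENNReal.toReal_mul, ENNReal.toReal_ofReal hc, ← measureReal_def]
  have key : ν s ≤ μ s := by
    refine measure_le_of_forall_isLocalEvent_le (fun A hA => ?_) hs
    have hAm := measurableSet_of_isLocalEvent_holds hA
    have := h A hA
    rw [← hνreal A hAm] at this
    exact (ENNReal.toReal_le_toReal (measure_ne_top ν A) (measure_ne_top μ A)).1 this
  rw [← hνreal s hs]
  exact (ENNReal.toReal_le_toReal (measure_ne_top ν s) (measure_ne_top μ s)).2 key

/-- **Insertion tolerance of `φ^b_{p,q}`** (Grimmett 2006, (3.4) / Thm. (4.17)(a), integrated): for a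
box limit `P` (`0 ≤ p ≤ 1`, `q ≥ 1`, either boundary condition), a finite set `F` of edges of `ℤ^d`
and every measurable event `A`, `(p/(p+q(1-p)))^{|F|} · P{ω | ω ∪ F ∈ A} ≤ P(A)`.
[cite: Grimmett2006, Thm. (4.17)(a) with Thm. (3.1), eq. (3.4)] -/
theorem IsBoxLimit.pow_mul_real_preimage_openEdges_le (hP : IsBoxLimit d b p q P)
    (hp : p ∈ Set.Icc (0 : ℝ) 1) (hq : 1 ≤ q) {F : Finset (Sym2 (Site d))}
    (hFE : (↑F : Set (Sym2 (Site d))) ⊆ (zdGraph d).edgeSet) {A : Set (BondConfig (Site d))}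
    (hA : MeasurableSet A) :
    (p / (p + q * (1 - p))) ^ F.card * P.real (openEdges ↑F ⁻¹' A) ≤ P.real A := by
  haveI := hP.isProbabilityMeasure
  exact mul_real_preimage_le_of_isLocalEvent (measurable_openEdges _)
    (pow_nonneg (div_nonneg hp.1 (insertionDenominator_pos hp hq).le) _)
    (fun A hA => hP.pow_mul_real_preimage_openEdges_le_of_isLocalEvent hp hq hFE hA) hA

/-- **Deletion tolerance of `φ^b_{p,q}`** (Grimmett 2006, (3.4) / Thm. (4.17)(a), integrated): for a
box limit `P` (`0 ≤ p ≤ 1`, `q ≥ 1`), a finite set `F` of pairs and every measurable event `A`,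
`(1-p)^{|F|} · P{ω | ω ∖ F ∈ A} ≤ P(A)`. [cite: Grimmett2006, Thm. (4.17)(a) with Thm. (3.1), eq. (3.4)] -/
theorem IsBoxLimit.pow_mul_real_preimage_sdiff_le (hP : IsBoxLimit d b p q P)
    (hp : p ∈ Set.Icc (0 : ℝ) 1) (hq : 1 ≤ q) (F : Finset (Sym2 (Site d)))
    {A : Set (BondConfig (Site d))} (hA : MeasurableSet A) :
    (1 - p) ^ F.card * P.real ((fun ω => ω \ ↑F) ⁻¹' A) ≤ P.real A := by
  haveI := hP.isProbabilityMeasure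
  exact mul_real_preimage_le_of_isLocalEvent (measurable_closeEdges _) (pow_nonneg (sub_nonneg.2 hp.2) _)
    (fun A hA => hP.pow_mul_real_preimage_sdiff_le_of_isLocalEvent hp hq F hA) hA

/-- **Box form of insertion tolerance** (the `insertion_tolerant` field of the tree's
`IsInsertionTolerantErgodic`): for `0 < p ≤ 1`, `q ≥ 1` and every box `Λ_N` there is `c > 0` with
`c · P{ω | ω ∪ E(Λ_N) ∈ S} ≤ P(S)` for all measurable `S`; `c = (p/(p+q(1-p)))^{|E(Λ_N)|}`.
[cite: Grimmett2006, Thm. (4.17)(a) with eq. (3.4)] -/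
theorem IsBoxLimit.insertion_tolerant (hP : IsBoxLimit d b p q P) (hp : p ∈ Set.Ioc (0 : ℝ) 1)
    (hq : 1 ≤ q) (N : ℕ) :
    ∃ c : ℝ, 0 < c ∧ ∀ {S : Set (BondConfig (Site d))}, MeasurableSet S →
      c * P.real (openEdges ↑(edgesIn (zdGraph d) (box d N)) ⁻¹' S) ≤ P.real S := by
  have hp' : p ∈ Set.Icc (0 : ℝ) 1 := ⟨hp.1.le, hp.2⟩
  refine ⟨(p / (p + q * (1 - p))) ^ (edgesIn (zdGraph d) (box d N)).card,
    pow_pos (div_pos hp.1 (insertionDenominator_pos hp' hq)) _, fun hS => ?_⟩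
  -- `↑(edgesIn (zdGraph d) (box d N)) ⊆ E(ℤ^d)` (the tree's `DKT20.coe_edgesIn_subset`, inlined to keep
  -- the import closure small)
  exact hP.pow_mul_real_preimage_openEdges_le hp' hq
    (fun _ he => (mem_edgesIn_iff.1 (Finset.mem_coe.1 he)).1) hS

/-- **Box form of deletion tolerance**: for `0 ≤ p < 1`, `q ≥ 1`, a box limit is deletion
tolerant in the sense of the tree's `IsDeletionTolerant` (`c = (1-p)^{|E(Λ_N)|}`).
[cite: Grimmett2006, Thm. (4.17)(a) with eq. (3.4)] -/
theorem IsBoxLimit.isDeletionTolerant (hP : IsBoxLimit d b p q P) (hp : p ∈ Set.Ico (0 : ℝ) 1)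
    (hq : 1 ≤ q) : IsDeletionTolerant P := by
  have hp' : p ∈ Set.Icc (0 : ℝ) 1 := ⟨hp.1, hp.2.le⟩
  intro N
  refine ⟨(1 - p) ^ (edgesIn (zdGraph d) (box d N)).card, pow_pos (sub_pos.2 hp.2) _,
    fun S hS => ?_⟩
  exact hP.pow_mul_real_preimage_sdiff_le hp' hq _ hS

/-- `rcLimit d b p q` is insertion tolerant on boxes (`0 < p ≤ 1`, `q ≥ 1`).
[cite: Grimmett2006, Thm. (4.17)(a) with eq. (3.4)] -/
theorem rcLimit_insertion_tolerant (b : Bool) {p q : ℝ} (hp : p ∈ Set.Ioc (0 : ℝ) 1) (hq : 1 ≤ q)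
    (N : ℕ) :
    ∃ c : ℝ, 0 < c ∧ ∀ {S : Set (BondConfig (Site d))}, MeasurableSet S →
      c * (rcLimit d b p q).real (openEdges ↑(edgesIn (zdGraph d) (box d N)) ⁻¹' S) ≤
        (rcLimit d b p q).real S :=
  (isBoxLimit_rcLimit b ⟨hp.1.le, hp.2⟩ hq).insertion_tolerant hp hq N

/-- `rcLimit d b p q` is deletion tolerant (`0 ≤ p < 1`, `q ≥ 1`). [cite: Grimmett2006, Thm. (4.17)(a) with eq. (3.4)] -/
theorem isDeletionTolerant_rcLimit (b : Bool) {p q : ℝ} (hp : p ∈ Set.Ico (0 : ℝ) 1) (hq : 1 ≤ q) :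
    IsDeletionTolerant (rcLimit d b p q) :=
  (isBoxLimit_rcLimit b ⟨hp.1, hp.2.le⟩ hq).isDeletionTolerant hp hq

end Limit

end Summit.CriticalPhenomena.PercolationContinuityZ3.Theorems.FK

end
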